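import Literature.AnabelianGeometry.SemiGraphs.CoverticialVertexCaseCovering
import Literature.AnabelianGeometry.SemiGraphs.PullbackFunctor
import HarnessLib

/-!
# [SemiAnbd] Proposition 2.6 (Commensurability) — the case of an elevated vertex

Mochizuki, *Semi-graphs of anabelioids*, Publ. RIMS **42** (2006), Proposition 2.6, author's
manuscript p. 28 [cite: MochizukiSemiAnbd2006, Prop. 2.6 pp.28-29]: "Let `𝒢` be a connected,
quasi-coherent graph of anabelioids. Let `ℍ, 𝕂 ⊆ 𝔾` be connected subgraphs … Suppose that there
exists a component `c` of `ℍ` that does not belong to `𝕂` and which is either an elevated vertex or a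
sub-coverticial edge. Then the intersection of `Π_ℍ` with any conjugate of `Π_𝕂` has infinite index in
`Π_ℍ`."  This file proves the case "`c = v` is a vertex" (`proposition_2_6_i_of_isElevated`), with the
binders of abc-iut-L3-t1's named fact `proposition_2_6` (`Coverticial.lean`); the edge case and the
assembly are abc-iut-L3-d1's (division of 2026-08-25).

Printed proof (pp. 28–29) as formalised: suppose `[Π_ℍ : Π_𝕂^g ∩ Π_ℍ] = m` is finite, `M := m + 1`;
`v` elevated gives a `π₁`-epimorphic approximator `φ : 𝒢 → 𝒢′` and `N_M ⊆ Π′_v` of order `≥ M`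
meeting all conjugates of the `Π′_b` trivially; the Galois covering `Y` of `𝒢′` and the local piece `P`
over `v` (`CoverticialVertexCaseCovering.lean`) are glued — here DOWNSTAIRS, by modifying `φ^* Y` at
`v` (`exists_modifiedCovering`) — into `A ∈ B(𝒢)` with fibre `S`; then (p. 29) "`Π″_𝕂` acts freely on
`S`" (`Π_𝕂` sees only `φ^* Y`: an element fixing one point of `S` fixes all), so an isotropy subgroup
of `Π″_ℍ` has `< M` elements acting distinctly (`finsetCard_le_relIndex_of_stabilizer`), whereas the
lifts of `N_M` along `Π_v ↠ Π′_v`, mapped into `Π_ℍ ⊆ Π_𝒢` through `B(𝒢_ℍ)` (`exists_transport_piH`),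
fix a point and act through `≥ M` distinct permutations — a contradiction.  Proof-only, no definitions.
Seat abc-iut-L6-t18.
-/

namespace Literature.AnabelianGeometry.SemiGraphs

open CategoryTheory CategoryTheory.Limits CategoryTheory.PreGaloisCategory
open Literature.AnabelianGeometry.Anabelioids
open scoped Pointwise

universe v₁ u₁ u

namespace SemiGraphOfAnabelioids

/-- **Gluing downstairs** (the covering `𝒢″` of [SemiAnbd] p. 28, realised as an object of `B(𝒢)`):
given `φ : 𝒢 → 𝒢′`, an object `Y ∈ B(𝒢′)` and a local piece `P` over `φ v` whose pull-backs to the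
branches at `φ v` are isomorphic to the edge constituents of `Y`, the object `φ^* Y` modified at `v` by
`φ_v^* P` is an object `A ∈ B(𝒢)` with `A_v = φ_v^* P` which AGREES WITH `φ^* Y` AWAY FROM `v`: for a
sub-semi-graph `𝕂 ∌ v`, an element of `Π_𝕂` acts on the fibre of `A` as on that of `φ^* Y`, so that if
elements of `Π_{𝒢′}` fixing one point of the fibre of `Y` fix all of it, the same holds for `Π_𝕂` on the
fibre of `A` ("`Π″_𝕂 = Π′_𝕂/K` … acts freely on `S`", p. 29). [cite: MochizukiSemiAnbd2006, Prop. 2.6 pp.28-29] -/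
theorem exists_modifiedCovering {𝒢 𝒢' : SemiGraphOfAnabelioids.{v₁, u₁, u}} (φ : Hom 𝒢 𝒢')
    (v : 𝒢.graph.Vertex) (Y : 𝒢'.BObj) (P : 𝒢'.V (φ.base.vertexMap v))
    (hglue : ∀ (b' : 𝒢'.graph.Branch) (h' : 𝒢'.graph.abuts b' = some (φ.base.vertexMap v)),
      Nonempty ((𝒢'.pull b' _ h').pullback.obj P ≅ Y.T (𝒢'.graph.edgeOf b'))) :
    ∃ A : 𝒢.BObj, A.S v = (φ.φV v).pullback.obj P ∧
      ∀ (K : 𝒢.graph.Subgraph) (_ : v ∉ K.verts) (w' : K.toSemiGraph.Vertex)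
        (F' : 𝒢.V w'.1 ⥤ FintypeCat.{v₁}) (κ : Aut ((𝒢.restrict K).ρ w' ⋙ F')),
        (∀ τ : Aut ((φ.pullbackFunctor ⋙ 𝒢.restrictFunctor K) ⋙ ((𝒢.restrict K).ρ w' ⋙ F')),
          (∃ y : ((φ.pullbackFunctor ⋙ 𝒢.restrictFunctor K) ⋙ ((𝒢.restrict K).ρ w' ⋙ F')).obj Y,
            τ • y = y) →
          ∀ y : ((φ.pullbackFunctor ⋙ 𝒢.restrictFunctor K) ⋙ ((𝒢.restrict K).ρ w' ⋙ F')).obj Y,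
            τ • y = y) →
        (∃ s : ((𝒢.restrict K).ρ w' ⋙ F').obj ((𝒢.restrictFunctor K).obj A), κ • s = s) →
        ∀ s : ((𝒢.restrict K).ρ w' ⋙ F').obj ((𝒢.restrictFunctor K).obj A), κ • s = s := by
  classical
  let B : 𝒢.BObj := φ.pullbackFunctor.obj Y
  let Q : 𝒢.V v := (φ.φV v).pullback.obj P
  -- the gluing at the branches abutting to `v`, transported downstairs along `φ_b`, `φ_e^*`
  have hv_iso : ∀ (b : 𝒢.graph.Branch) (h : 𝒢.graph.abuts b = some v),
      Nonempty ((𝒢.pull b v h).pullback.obj Q ≅ B.T (𝒢.graph.edgeOf b)) := by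
    intro b h
    obtain ⟨u⟩ := hglue (φ.base.branchMap b) (φ.base.abuts_branchMap b v h)
    exact ⟨(φ.φB b v h).app P ≪≫
      (φ.φE (𝒢.graph.edgeOf b) (𝒢'.graph.edgeOf (φ.base.branchMap b))
        (φ.base.edgeOf_branchMap b).symm).pullback.mapIso u ≪≫
      (φ.reindexIso (𝒢.graph.edgeOf b) _ _ (φ.base.edgeOf_branchMap b).symm rfl).app Y⟩
  let S' : ∀ x : 𝒢.graph.Vertex, 𝒢.V x := Function.update B.S v Q
  let ψA : ∀ (b : 𝒢.graph.Branch) (x : 𝒢.graph.Vertex) (h : 𝒢.graph.abuts b = some x),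
      (𝒢.pull b x h).pullback.obj (S' x) ≅ B.T (𝒢.graph.edgeOf b) := fun b x h =>
    if hx : x = v then by
      subst hx
      exact eqToIso (by simp only [S', Function.update_self]) ≪≫ (hv_iso b h).some
    else (𝒢.pull b x h).pullback.mapIso (eqToIso (Function.update_of_ne hx Q B.S)) ≪≫ B.ψ b x h
  let A : 𝒢.BObj := ⟨S', B.T, ψA⟩
  refine ⟨A, Function.update_self v Q B.S, ?_⟩
  intro K hvK w' F' κ hY hs s'
  obtain ⟨s, hs⟩ := hs
  let Ψ := (𝒢.restrict K).ρ w' ⋙ F'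
  have hne : ∀ x : K.toSemiGraph.Vertex, x.1 ≠ v := fun x hx => hvK (hx ▸ x.2)
  -- the comparison morphism `A|_𝕂 ⟶ (φ^* Y)|_𝕂` (identity away from `v`)
  let j : (𝒢.restrictFunctor K).obj A ⟶ (𝒢.restrictFunctor K).obj B :=
    { fS := fun x => eqToHom (Function.update_of_ne (hne x) Q B.S)
      fT := fun e => 𝟙 _
      comm := fun b x h => by
        change (𝒢.pull b.1 x.1 _).pullback.map (eqToHom _) ≫ (B.ψ b.1 x.1 _).hom =
          (ψA b.1 x.1 _).hom ≫ 𝟙 _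
        rw [Category.comp_id]
        simp only [ψA, dif_neg (hne x), Iso.trans_hom, Functor.mapIso_hom, eqToIso.hom] }
  have hiso : IsIso (Ψ.map j) := by
    change IsIso (F'.map (eqToHom (Function.update_of_ne (hne w') Q B.S)))
    infer_instance
  have hbij : Function.Bijective (Ψ.map j) := ConcreteCategory.bijective_of_isIso (Ψ.map j)
  have hnat : ∀ (σ : Aut Ψ) (y : Ψ.obj ((𝒢.restrictFunctor K).obj A)),
      σ • Ψ.map j y = Ψ.map j (σ • y) := fun σ y => mulAction_naturality Ψ σ j y
  -- `κ` fixes a point of the fibre of `(φ^* Y)|_𝕂`, hence all of it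
  have h1 : ∀ y : Ψ.obj ((𝒢.restrictFunctor K).obj B), κ • y = y := by
    have h0 : κ • Ψ.map j s = Ψ.map j s := by rw [hnat, hs]
    exact hY (pi1Map (φ.pullbackFunctor ⋙ 𝒢.restrictFunctor K) Ψ κ) ⟨Ψ.map j s, h0⟩
  apply hbij.1
  rw [← hnat, h1]

/-- **Transport through `B(𝒢_ℍ)`** ("we denote the images … by a double dash", p. 29): for a connected
sub-semi-graph `ℍ ∋ v` with basepoint `F` through a vertex `w` of `ℍ` and a basepoint `F_v` of `𝒢_v`,
there are a map `ι : Π_v → Π_𝒢` with values in `Π_ℍ ⊆ Π_𝒢` and, for any `A ∈ B(𝒢)`, a bijection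
`F_v(A_v) ≃ F(A_w)` intertwining `σ` and `ι σ` (an isomorphism of basepoints of the Galois category
`B(𝒢_ℍ)`, abc-iut-L3-t9's `galoisCategory_bObj`). [cite: MochizukiSemiAnbd2006, Prop. 2.6 p.29] -/
theorem exists_transport_piH (𝒢 : SemiGraphOfAnabelioids.{v₁, u₁, u}) (H : 𝒢.graph.Subgraph)
    (hH : H.toSemiGraph.IsConnected) (v : 𝒢.graph.Vertex) (hvH : v ∈ H.verts)
    (Fv : 𝒢.V v ⥤ FintypeCat.{v₁}) [FiberFunctor Fv] (w : H.toSemiGraph.Vertex)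
    (F : 𝒢.V w.1 ⥤ FintypeCat.{v₁}) [FiberFunctor F] (A : 𝒢.BObj) :
    ∃ (ι : Aut Fv → 𝒢.Pi w.1 F) (bij : Fv.obj (A.S v) ≃ (𝒢.ρ w.1 ⋙ F).obj A),
      (∀ σ, ι σ ∈ (𝒢.piHToPi H w F).range) ∧ ∀ (σ : Aut Fv) (t : Fv.obj (A.S v)),
        ι σ • bij t = bij (σ • t) := by
  letI := (𝒢.restrict H).preGaloisCategory_bObj
  have hcH : (𝒢.restrict H).IsConnected := ⟨hH⟩
  haveI : GaloisCategory (𝒢.restrict H).BObj := (𝒢.restrict H).galoisCategory_bObj hcH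
  -- the basepoints, re-keyed on the constituents of the restricted semi-graph of anabelioids
  haveI : @FiberFunctor ((𝒢.restrict H).V ⟨v, hvH⟩) ((𝒢.restrict H).catV ⟨v, hvH⟩)
      ((𝒢.restrict H).galV ⟨v, hvH⟩).toPreGaloisCategory Fv := ‹FiberFunctor Fv›
  haveI : @FiberFunctor ((𝒢.restrict H).V w) ((𝒢.restrict H).catV w)
      ((𝒢.restrict H).galV w).toPreGaloisCategory F := ‹FiberFunctor F›
  haveI : FiberFunctor ((𝒢.restrict H).ρ ⟨v, hvH⟩ ⋙ Fv) :=
    (𝒢.restrict H).fiberFunctor_ρ hcH ⟨v, hvH⟩ Fv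
  haveI : FiberFunctor ((𝒢.restrict H).ρ w ⋙ F) := (𝒢.restrict H).fiberFunctor_ρ hcH w F
  obtain ⟨β⟩ := nonempty_iso_of_fiberFunctor' ((𝒢.restrict H).ρ ⟨v, hvH⟩ ⋙ Fv)
    ((𝒢.restrict H).ρ w ⋙ F)
  let τ : Aut Fv → Aut ((𝒢.restrict H).ρ ⟨v, hvH⟩ ⋙ Fv) :=
    fun σ => pi1Map ((𝒢.restrict H).ρ ⟨v, hvH⟩) Fv σ
  refine ⟨fun σ => 𝒢.piHToPi H w F (β.conjAut (τ σ)),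
    Equiv.ofBijective (β.hom.app ((𝒢.restrictFunctor H).obj A))
      (bijective_hom_app β ((𝒢.restrictFunctor H).obj A)),
    fun σ => ⟨_, rfl⟩, fun σ t => ?_⟩
  change (β.conjAut (τ σ)) • (β.hom.app ((𝒢.restrictFunctor H).obj A) t) =
    β.hom.app ((𝒢.restrictFunctor H).obj A) (σ • t)
  rw [conjAut_smul_app]
  rfl

/-- **[SemiAnbd] Proposition 2.6 (Commensurability), case of an elevated vertex** (pp. 28–29):
for a connected quasi-coherent graph of anabelioids `𝒢`, connected subgraphs `ℍ, 𝕂`, and an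
ELEVATED vertex `v ∈ ℍ ∖ 𝕂`, the intersection of `Π_ℍ` with any conjugate of `Π_𝕂` has infinite
index in `Π_ℍ` — clause 1 of abc-iut-L3-t1's `proposition_2_6`, with its binders (`Π_ℍ`, `Π_𝕂` inside
`Π_𝒢` for the basepoint through `w ∈ ℍ`, `Π_𝕂` mapped in along `α`).  The hypotheses "graph of
anabelioids", "quasi-coherent" and "`𝕂` connected" are not used in this case (the approximator of
Def. 2.4 (i) is all the proof needs). [cite: MochizukiSemiAnbd2006, Prop. 2.6 pp.28-29] -/
theorem proposition_2_6_i_of_isElevated (𝒢 : SemiGraphOfAnabelioids.{v₁, u₁, u})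
    (hc : 𝒢.IsConnected) (_hgr : 𝒢.IsGraphOfAnabelioids) (_hqc : 𝒢.IsQuasiCoherent)
    (H K : 𝒢.graph.Subgraph) (hH : H.toSemiGraph.IsConnected) (_hK : K.toSemiGraph.IsConnected)
    (v : 𝒢.graph.Vertex) (hvH : v ∈ H.verts) (hvK : v ∉ K.verts) (hv : 𝒢.IsElevated v)
    (w : H.toSemiGraph.Vertex) (F : 𝒢.V w.1 ⥤ FintypeCat.{v₁}) [FiberFunctor F]
    (w' : K.toSemiGraph.Vertex) (F' : 𝒢.V w'.1 ⥤ FintypeCat.{v₁}) [FiberFunctor F']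
    (α : 𝒢.ρ w'.1 ⋙ F' ≅ 𝒢.ρ w.1 ⋙ F) (g : 𝒢.Pi w.1 F) :
    (ConjAct.toConjAct g •
        ((Aut.autMulEquivOfIso α).toMonoidHom.comp (𝒢.piHToPi K w' F')).range).relIndex
      (𝒢.piHToPi H w F).range = 0 := by
  classical
  by_contra hne
  -- `M := [Π_ℍ : Π_𝕂^g ∩ Π_ℍ] + 1`
  obtain ⟨𝒢', φ, hφ, hN⟩ := hv ((ConjAct.toConjAct g •
    ((Aut.autMulEquivOfIso α).toMonoidHom.comp (𝒢.piHToPi K w' F')).range).relIndex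
      (𝒢.piHToPi H w F).range + 1) (Nat.le_add_left 1 _)
  -- the approximator `φ : 𝒢 → 𝒢'`
  haveI := hφ.isApproximator.isIso_base
  have hbo' : 𝒢'.IsOfBoundedOrder := hφ.isApproximator.isOfBoundedOrder
  have hc' : 𝒢'.IsConnected := ⟨SemiGraph.isConnected_of_isIso φ.base hc.isConnected⟩
  letI := 𝒢'.preGaloisCategory_bObj
  -- basepoints: `β_v` of `𝒢_v`, `φ_v ∘ β_v` of `𝒢'_{φ v}`, `φ_{w'} ∘ F'` of `𝒢'_{φ w'}`
  let Fv : 𝒢.V v ⥤ FintypeCat.{v₁} := GaloisCategory.getFiberFunctor (𝒢.V v)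
  let F₁ : 𝒢'.V (φ.base.vertexMap v) ⥤ FintypeCat.{v₁} := (φ.φV v).pullback ⋙ Fv
  haveI : FiberFunctor F₁ := fiberFunctor_comp_of_exact (φ.φV v).pullback Fv
  let F'' : 𝒢'.V (φ.base.vertexMap w'.1) ⥤ FintypeCat.{v₁} := (φ.φV w'.1).pullback ⋙ F'
  haveI : FiberFunctor F'' := fiberFunctor_comp_of_exact (φ.φV w'.1).pullback F'
  -- `N_M ⊆ Π'_v`
  obtain ⟨N, hNfin, hNcard, hNdisj⟩ := hN F₁
  haveI := hNfin
  haveI : Fintype N := Fintype.ofFinite N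
  obtain ⟨M₀, -, hbd'⟩ := hbo'.exists_bound
  haveI : Finite (Aut F₁) := (hbd' _ F₁).1
  -- the Galois covering of `𝒢'`, the local piece over `φ v`, their gluing
  obtain ⟨Y, d, hd, hY1, hYV, hYB⟩ := 𝒢'.exists_galoisCovering hc' hbo' (φ.base.vertexMap w'.1) F''
  obtain ⟨-, -, hdvd⟩ := hYV (φ.base.vertexMap v) F₁
  obtain ⟨P, -, ⟨t₀, ht₀, hNinj⟩, hPB⟩ := 𝒢'.exists_vertexPiece hbo'.isOfInjectiveType
    (φ.base.vertexMap v) F₁ hdvd hd N (fun b h Fe _ α' g' => hNdisj b h Fe α' g')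
  have hglue : ∀ (b' : 𝒢'.graph.Branch) (h' : 𝒢'.graph.abuts b' = some (φ.base.vertexMap v)),
      Nonempty ((𝒢'.pull b' _ h').pullback.obj P ≅ Y.T (𝒢'.graph.edgeOf b')) := by
    intro b' h'
    let Fe := GaloisCategory.getFiberFunctor (𝒢'.E (𝒢'.graph.edgeOf b'))
    haveI : Finite (Aut Fe) := 𝒢'.finite_aut_edge_of_isOfBoundedOrder hbo' b' _ h' Fe
    obtain ⟨hf1, hc1⟩ := hPB b' h' Fe
    obtain ⟨hf2, hc2⟩ := hYB b' _ h' Fe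
    exact nonempty_iso_of_free Fe hf1 hf2 (hc1.trans hc2.symm)
  -- `A ∈ B(𝒢)`: `φ^* Y` modified at `v`; `S := β_w(A_w)` with its `Π_𝒢`-action
  obtain ⟨A, hAv, hAK⟩ := exists_modifiedCovering φ v Y P hglue
  -- (p. 29) an element of `Π_𝕂^g` fixing one point of `S` fixes all of `S`
  have hΔ : ∀ δ ∈ ConjAct.toConjAct g •
      ((Aut.autMulEquivOfIso α).toMonoidHom.comp (𝒢.piHToPi K w' F')).range,
      (∃ s : (𝒢.ρ w.1 ⋙ F).obj A, δ • s = s) → ∀ s : (𝒢.ρ w.1 ⋙ F).obj A, δ • s = s := by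
    intro δ hδ ⟨s, hs⟩ s₁
    rw [Subgroup.mem_pointwise_smul_iff_inv_smul_mem] at hδ
    obtain ⟨κ, hκ⟩ := hδ
    -- `k := g⁻¹ δ g = α (π_𝕂 κ) α⁻¹`
    set ξ := 𝒢.piHToPi K w' F' κ with hξ
    have hk : α.conjAut ξ = (ConjAct.toConjAct g)⁻¹ • δ := by
      rw [← hκ, MonoidHom.comp_apply, MulEquiv.coe_toMonoidHom, autMulEquivOfIso_apply]
    have hk' : ∀ t : (𝒢.ρ w.1 ⋙ F).obj A, (α.conjAut ξ) • t = g⁻¹ • δ • g • t := by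
      intro t
      rw [hk, ← map_inv, ConjAct.smul_def, ConjAct.ofConjAct_toConjAct, inv_inv, mul_smul, mul_smul]
    -- `ξ` fixes a point of the fibre of `A` at `w'`
    have hsurjα : Function.Surjective (α.hom.app A) := (bijective_hom_app α A).2
    obtain ⟨t, ht⟩ := hsurjα (g⁻¹ • s)
    have hξt : ξ • t = t := by
      apply (bijective_hom_app α A).1
      rw [← conjAut_smul_app, hk', ht, smul_inv_smul, hs]
    -- hence, via `Π_𝕂`'s view of `A` (= of `φ^* Y`), `κ` acts trivially
    haveI : FiberFunctor ((φ.pullbackFunctor ⋙ 𝒢.restrictFunctor K) ⋙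
        ((𝒢.restrict K).ρ w' ⋙ F')) := 𝒢'.fiberFunctor_ρ hc' (φ.base.vertexMap w'.1) F''
    have hall := hAK K hvK w' F' κ (fun τ hτ y => hY1 _ τ hτ y) ⟨t, hξt⟩
    -- so `k`, hence `δ`, acts trivially on `S`
    obtain ⟨t₁, ht₁'⟩ := hsurjα (g⁻¹ • s₁)
    have h1 : (α.conjAut ξ) • (α.hom.app A t₁) = α.hom.app A t₁ := by
      rw [conjAut_smul_app]
      exact congrArg _ (hall t₁)
    rw [hk', ht₁', smul_inv_smul] at h1
    have h2 := congrArg (fun u => g • u) h1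
    simpa only [smul_inv_smul] using h2
  -- (p. 29) `Π_v → Π_ℍ ⊆ Π_𝒢` through `B(𝒢_ℍ)`, with the identification of fibres
  obtain ⟨ι, bij, hιH, hιeq⟩ := 𝒢.exists_transport_piH H hH v hvH Fv w F A
  -- the local piece seen from `𝒢_v`: a point fixed by the lifts of `N_M`, which act distinctly
  have hsurj : Function.Surjective (pi1Map (φ.φV v).pullback Fv) := hφ.isPi1Epi_V v Fv
  choose sec hsec using fun n : N => hsurj n.1
  have key : ∀ (R : 𝒢.V v), R = (φ.φV v).pullback.obj P →
      ∃ t₁ : Fv.obj R, (∀ n : N, sec n • t₁ = t₁) ∧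
        ∀ n n' : N, (∀ t : Fv.obj R, sec n • t = sec n' • t) → n = n' := by
    rintro R rfl
    refine ⟨t₀, fun n => ?_, fun n n' hnn => ?_⟩
    · have := ht₀ n.1 n.2
      rwa [← hsec n] at this
    · have h := hNinj n.1 n.2 n'.1 n'.2 (fun t => by
        have := hnn t
        rwa [← hsec n, ← hsec n'])
      exact Subtype.ext h
  obtain ⟨t₁, ht₁, hsep⟩ := key (A.S v) hAv
  -- the family `E` of lifts inside `Π_ℍ`: it fixes `bij t₁`, acts distinctly, and has `|N| ≥ M` members
  let f : N → 𝒢.Pi w.1 F := fun n => ι (sec n)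
  have hf : ∀ n n' : N, (∀ s : (𝒢.ρ w.1 ⋙ F).obj A, f n • s = f n' • s) → n = n' := by
    intro n n' hnn
    refine hsep n n' fun t => bij.injective ?_
    rw [← hιeq, ← hιeq]
    exact hnn (bij t)
  have hfinj : Function.Injective f := fun n n' h => hf n n' (fun s => by rw [h])
  let E : Finset (𝒢.Pi w.1 F) := Finset.univ.image f
  have hEcard : E.card = Nat.card N := by
    rw [Finset.card_image_of_injective _ hfinj, Finset.card_univ, Nat.card_eq_fintype_card]
  have hle := finsetCard_le_relIndex_of_stabilizer (𝒢.piHToPi H w F).range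
    (ConjAct.toConjAct g • ((Aut.autMulEquivOfIso α).toMonoidHom.comp (𝒢.piHToPi K w' F')).range)
    hΔ hne (bij t₁) E
    (fun γ hγ => by
      obtain ⟨n, -, rfl⟩ := Finset.mem_image.mp hγ
      exact hιH _)
    (fun γ hγ => by
      obtain ⟨n, -, rfl⟩ := Finset.mem_image.mp hγ
      change ι (sec n) • bij t₁ = bij t₁
      rw [hιeq, ht₁])
    (fun γ hγ γ' hγ' hγγ => by
      obtain ⟨n, -, rfl⟩ := Finset.mem_image.mp hγ
      obtain ⟨n', -, rfl⟩ := Finset.mem_image.mp hγ'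
      rw [hf n n' hγγ])
  rw [hEcard] at hle
  omega

end SemiGraphOfAnabelioids

end Literature.AnabelianGeometry.SemiGraphs
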